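import Summits.ResolutionOfSingularities.ResolutionOfSingularities.Theorems.EquisingularLiftEquisingularLiftCentreBlowupGoodAt
import Summits.ResolutionOfSingularities.ResolutionOfSingularities.Theorems.EquisingularLiftEquisingularLiftSmoothNhdOfGoodAt
import Summits.ResolutionOfSingularities.ResolutionOfSingularities.Theorems.EquisingularLiftEquisingularLiftResolveOnePointDimOne
import Literature.AlgebraicGeometry.Resolution.SmoothOfRegularFibre
import Literature.AlgebraicGeometry.Resolution.SmoothLocusBaseChange
import Literature.AlgebraicGeometry.Resolution.BlowupsIntegral
import Literature.AlgebraicGeometry.Resolution.BlowupsProperProofs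
import Literature.AlgebraicGeometry.Motives.FiberStalk
import Literature.AlgebraicGeometry.Motives.ZariskiChowCover
import HarnessLib

/-!
# `EquisingularLift`, line `Sketch` — blowing up an `O`-smooth centre keeps the ambient smooth over `O` (helper T1b)

Crux `stmt-ResolutionOfSingularities-15660` = `Theses.EquisingularLift.EquisingularLift`; helper T1b of `L/w45b/CRUX-PLAN.md`
§3/§6 for the research stub `stub_horizResolution_three` (skeleton v9): along the lead's upstairs induction the running ambient
`X'_i → Spec O` should stay SMOOTH, so that closed points of the special fibre keep lifting to sections (T1, Hensel). CLAIM
(`smooth_of_isBlowup_smoothCentre`): for a discrete valuation ring `O` of characteristic `0` with algebraically closed residue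
field, `U` integral and smooth over `Spec O`, and a centre `K ≠ ⊥` with `V(K) → Spec O` SMOOTH, every blow-up `U' = Bl_K U`
is again smooth over `Spec O`.

Proof. (1) `GoodAt` everywhere on `U'` (H4 = `goodAt_of_isBlowup_regularCentre`, p461630: `V(K)` is regular and `O`-flat, and
its special fibre `V(K·𝒪_{U_κ}) ≅ V(K) ×_{Spec O} Spec κ` is smooth over `κ`, hence regular). (2) `U' → Spec O` is locally of
finite presentation (`Bl` is proper, Stacks 02NS) and FLAT: `U'` is integral and DOMINANT over `Spec O`
(`flat_of_isIntegral_of_isDominant`, Hartshorne III 9.7 with "surjective" weakened to "dominant"; the blow-up is dominant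
onto `U`, `isDominant_of_isBlowup`, and the smooth `U → Spec O` is open). (3) `smooth_of_goodAt`: at a point of the special
fibre good reduction gives a smooth neighbourhood (`exists_smooth_nhd_of_goodAt`, p163543: fibrewise criterion over the perfect
residue field); at a point of the generic fibre the local ring of the fibre IS the (regular) local ring and the residue field
of the generic point has characteristic `0`, so the fibrewise criterion (`mem_smoothLocus_of_isRegularLocalRing_stalk_fiber`,
Stacks 01V8) applies again; smoothness is local on the source.

* `flat_of_isIntegral_of_isDominant`, `isDominant_of_isBlowup`, `isDominant_of_smooth_of_nonempty` — flatness tools;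
* `smooth_of_goodAt` — good reduction everywhere + flat + locally of finite presentation ⇒ smooth (char-0 DVR, `κ = κ̄`);
* `smooth_of_isBlowup_smoothCentre` — the claim.

References: R. Hartshorne, *Algebraic Geometry*, Springer 1977, III Prop. 9.7, II Prop. 8.24; The Stacks Project, Tags 01V8,
02NS; A. Grothendieck, J. Dieudonné, *EGA IV₄*, Publ. Math. IHÉS 32 (1967), Thm. 17.5.1.
-/

set_option linter.dupNamespace false -- mandated namespace `Summit.<Summit>.<Problem>` of this single-conjunct summit
set_option linter.overlappingInstances false -- the signatures carry both [IsDomain O] and [IsDiscreteValuationRing O]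

noncomputable section

namespace Summit.ResolutionOfSingularities.ResolutionOfSingularities.Cruxes.EquisingularLift.StrataSplit

open CategoryTheory CategoryTheory.Limits AlgebraicGeometry TopologicalSpace Topology
open IsLocalRing Literature.AlgebraicGeometry.Resolution
open Summit.ResolutionOfSingularities.ResolutionOfSingularities.Theses.EquisingularLift.Split

/-! ## Flatness over a principal ideal domain from dominance -/

/-- **An integral scheme dominant over the spectrum of a principal ideal domain is flat over it** (flat = torsion-free
over a Bézout domain; the rings of functions of the non-empty affine opens of `Z` are domains into which `R` injects, `Z → Spec R`
being dominant). The tree's `ZariskiChow.flat_of_isIntegral_of_surjective` with "surjective" weakened to "dominant".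
[cite: Hartshorne1977, III Prop. 9.7 p. 257] -/
theorem flat_of_isIntegral_of_isDominant {R : Type} [CommRing R] [IsDomain R] [IsPrincipalIdealRing R] {Z : Scheme.{0}}
    (g : Z ⟶ Spec (.of R)) [IsIntegral Z] [IsDominant g] : Flat g := by
  -- adapted from Literature.AlgebraicGeometry.Motives.ZariskiChow.flat_of_isIntegral_of_surjective
  apply HasRingHomProperty.of_iSup_eq_top (P := @Flat) (fun V : Z.affineOpens => V)
    (iSup_affineOpens_eq_top Z)
  intro V
  set φ := (g.appLE ⊤ (V : Z.Opens) le_top).hom with hφ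
  letI := φ.toAlgebra
  change Module.Flat Γ(Spec (.of R), ⊤) Γ(Z, V)
  let eR : R ≃+* Γ(Spec (.of R), ⊤) := (Scheme.ΓSpecIso (.of R)).symm.commRingCatIsoToRingEquiv
  haveI : IsDomain Γ(Spec (.of R), ⊤) := MulEquiv.isDomain R eR.symm.toMulEquiv
  haveI : IsPrincipalIdealRing Γ(Spec (.of R), ⊤) := IsPrincipalIdealRing.of_surjective eR.toRingHom eR.surjective
  rw [Module.Flat.flat_iff_torsion_eq_bot_of_isBezout, ← Submodule.isTorsionFree_iff_torsion_eq_bot]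
  rcases isEmpty_or_nonempty (V : Z.Opens) with hV | hV
  · have hbot : (V : Z.Opens) = ⊥ := by
      ext x
      exact ⟨fun hx => (hV.false ⟨x, hx⟩).elim, fun hx => hx.elim⟩
    haveI : Subsingleton Γ(Z, V) := CommRingCat.subsingleton_of_isTerminal (Z.sheaf.isTerminalOfEqEmpty hbot)
    infer_instance
  haveI : IsDomain Γ(Z, V) := inferInstance
  have hinj : Function.Injective φ := by
    have hdense : Dense ((V : Z.Opens) : Set Z) := (V : Z.Opens).2.dense
      (by obtain ⟨x⟩ := hV; exact ⟨x.1, x.2⟩)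
    haveI : IsDominant (V : Z.Opens).ι := Opens.isDominant_ι hdense
    haveI : IsDominant ((V : Z.Opens).ι ≫ g) := inferInstance
    haveI : IsSchemeTheoreticallyDominant ((V : Z.Opens).ι ≫ g) :=
      IsSchemeTheoreticallyDominant.of_isDominant _
    haveI : IsAffine (V : Z.Opens) := V.2
    have h1 := ((V : Z.Opens).ι ≫ g).app_injective ⊤
    rw [Scheme.Hom.comp_app, Scheme.Opens.ι_app] at h1
    have e : (V : Z.Opens).ι ''ᵁ ((V : Z.Opens).ι ⁻¹ᵁ (g ⁻¹ᵁ ⊤)) = V := by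
      change (V : Z.Opens).ι ''ᵁ ⊤ = V
      exact Scheme.Opens.ι_image_top _
    exact Literature.AlgebraicGeometry.Motives.ZariskiChow.injective_comp_map_of_eq e _
      (le_top : (V : Z.Opens) ≤ g ⁻¹ᵁ ⊤) (g.app ⊤) h1
  haveI : FaithfulSMul Γ(Spec (.of R), ⊤) Γ(Z, V) := (faithfulSMul_iff_algebraMap_injective _ _).mpr hinj
  infer_instance

/-- **A blow-up of an integral scheme along a non-zero ideal sheaf is dominant**: its image contains the dense open complement
of the centre, over which the blow-up is an isomorphism (`IsBlowup.isIso_compl`). [folklore] -/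
theorem isDominant_of_isBlowup {X' X : Scheme.{0}} {π : X' ⟶ X} {J : X.IdealSheafData} [IsIntegral X]
    (hπ : IsBlowup π J) (hJ : J ≠ ⊥) : IsDominant π := by
  haveI : IsIso (π ∣_ centreCompl J) := hπ.isIso_compl
  have hsub : ((centreCompl J : X.Opens) : Set X) ⊆ Set.range π := by
    intro x hx
    obtain ⟨z, hz⟩ := (π ∣_ centreCompl J).surjective ⟨x, hx⟩
    refine ⟨z.1, ?_⟩
    have h := morphismRestrict_base_coe π (centreCompl J) z
    rw [hz] at h
    exact h.symm
  exact ⟨((centreCompl J).2.dense (centreCompl_nonempty hJ)).mono hsub⟩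

/-- **A smooth morphism from a non-empty scheme to the spectrum of a domain is dominant**: it is open (flat and locally of
finite presentation, Stacks 01UA), and a non-empty open subset of the irreducible `Spec O` is dense. [folklore] -/
theorem isDominant_of_smooth_of_nonempty {O : Type} [CommRing O] [IsDomain O] {U : Scheme.{0}} (r : U ⟶ Spec (.of O))
    [Smooth r] [Nonempty U] : IsDominant r := by
  have hopen : IsOpen (Set.range r) := r.isOpenMap.isOpen_range
  exact ⟨hopen.dense (Set.range_nonempty _)⟩

/-! ## Good reduction everywhere implies smoothness (characteristic-`0` DVR with algebraically closed residue field) -/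

/-- **Good reduction at every point + flat + locally of finite presentation ⇒ smooth** over a discrete valuation ring `O` of
characteristic `0` with algebraically closed residue field. At a point of the special fibre this is
`exists_smooth_nhd_of_goodAt` (fibrewise criterion of smoothness over the perfect residue field, Stacks 01V8); at a point `x` of
the generic fibre the local ring of `Spec O` at the generic point is the fraction field (its maximal ideal is `0`), so the local
ring of the fibre at `x` is `𝒪_{X,x}` itself, regular by hypothesis, and the residue field has characteristic `0`, hence is
perfect — the fibrewise criterion applies again (`mem_smoothLocus_of_isRegularLocalRing_stalk_fiber`). Smoothness is local on
the source. [cite: StacksProject, Tag 01V8] -/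
theorem smooth_of_goodAt (O : Type) [CommRing O] [IsDomain O] [IsDiscreteValuationRing O] [CharZero O]
    [IsAlgClosed (ResidueField O)] (X : Scheme.{0}) (f : X ⟶ Spec (.of O)) [LocallyOfFinitePresentation f] [Flat f]
    (h : ∀ x : X, GoodAt f x) : Smooth f := by
  -- a smooth open neighbourhood of every point
  have key : ∀ x : X, ∃ V : X.Opens, x ∈ V ∧ Smooth (V.ι ≫ f) := by
    intro x
    by_cases hx : f x = closedPoint O
    · exact exists_smooth_nhd_of_goodAt O X f ‹_› ‹_› x hx (h x)
    · -- `x` lies over the generic point `η`: `(f x).asIdeal = ⊥`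
      have hy : (f x).asIdeal = ⊥ := by
        by_contra hne
        apply hx
        have hmax : (f x).asIdeal.IsMaximal := (f x).2.isMaximal hne
        exact PrimeSpectrum.ext (IsLocalRing.eq_maximalIdeal hmax)
      -- the local ring `R = 𝒪_{Spec O, η}` has maximal ideal `0` and characteristic `0`
      set R := (Spec (.of O)).presheaf.stalk (f x) with hR
      set S := X.presheaf.stalk x with hS
      letI : Algebra O R := StructureSheaf.stalkAlgebra O (f x)
      haveI : IsLocalization.AtPrime R (f x).asIdeal := StructureSheaf.IsLocalization.to_stalk O (f x)
      have hmR : maximalIdeal R = ⊥ := by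
        rw [← IsLocalization.AtPrime.map_eq_maximalIdeal (f x).asIdeal R, hy, Ideal.map_bot]
      have hM : (f x).asIdeal.primeCompl ≤ nonZeroDivisors O := fun a ha => by
        apply mem_nonZeroDivisors_of_ne_zero
        intro ha0
        apply ha
        rw [hy, ha0]
        exact Ideal.zero_mem _
      haveI : CharZero R := charZero_of_injective_algebraMap (IsLocalization.injective R hM)
      have hres : Function.Injective (IsLocalRing.residue R) := by
        rw [RingHom.injective_iff_ker_eq_bot, IsLocalRing.ker_residue, hmR]
      haveI : CharZero (ResidueField R) := charZero_of_injective_ringHom hres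
      haveI : PerfectField ((Spec (.of O)).residueField (f x)) := inferInstanceAs (PerfectField (ResidueField R))
      -- the local ring of the generic fibre at `x` is `𝒪_{X,x}`, which is regular
      haveI : IsRegularLocalRing S := (h x).1
      have hbot : (⊥ : Ideal S) = (maximalIdeal R).map (f.stalkMap x).hom := by
        rw [hmR, Ideal.map_bot]
      haveI : IsRegularLocalRing (S ⧸ (maximalIdeal R).map (f.stalkMap x).hom) :=
        IsRegularLocalRing.of_ringEquiv ((RingEquiv.quotientBot S).symm.trans (Ideal.quotEquivOfEq hbot))
      obtain ⟨e₀⟩ := Literature.AlgebraicGeometry.Motives.nonempty_stalkFiber_ringEquiv_asFiber f x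
      have hfib : IsRegularLocalRing ((f.fiber (f x)).presheaf.stalk (f.asFiber x)) :=
        IsRegularLocalRing.of_ringEquiv e₀.symm
      exact exists_smooth_ι_comp_of_mem_smoothLocus f (mem_smoothLocus_of_isRegularLocalRing_stalk_fiber f x hfib)
  choose V hV hsm using key
  refine IsZariskiLocalAtSource.of_iSup_eq_top (P := @Smooth) V ?_ hsm
  rw [eq_top_iff]
  rintro x -
  exact Opens.mem_iSup.mpr ⟨x, hV x⟩

/-! ## T1b: blowing up an `O`-smooth centre keeps smoothness -/

/-- **Blowing up an `O`-smooth centre keeps the ambient smooth over `O`.** Let `O` be a discrete valuation ring of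
characteristic `0` with algebraically closed residue field, `U` an integral scheme with `r : U → Spec O` smooth, `K ≠ ⊥` an ideal
sheaf on `U` with `V(K) → Spec O` smooth, and `τ : U' → U` a blow-up of `U` along `K`. Then `U' → Spec O` is smooth. Proof:
good reduction everywhere (`goodAt_of_isBlowup_regularCentre`: `V(K)` is regular and `O`-flat with regular special fibre
`V(K·𝒪_{U_κ}) ≅ V(K) ×_{Spec O} Spec κ`), `U'` integral and dominant hence flat over the PID `O`, locally of finite
presentation (blow-ups are proper, Stacks 02NS), and `smooth_of_goodAt`. [folklore; Hartshorne1977 II Prop. 8.24 / Liu2002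
Thm. 8.1.19 for the regularity, Stacks 01V8 for the fibrewise criterion] -/
theorem smooth_of_isBlowup_smoothCentre : ∀ (O : Type) [CommRing O] [IsDomain O] [IsDiscreteValuationRing O] [CharZero O] [IsAlgClosed (IsLocalRing.ResidueField O)] (U U' : AlgebraicGeometry.Scheme.{0}) [AlgebraicGeometry.IsIntegral U] (r : U ⟶ AlgebraicGeometry.Spec (.of O)) [AlgebraicGeometry.Smooth r] (K : U.IdealSheafData), K ≠ ⊥ → AlgebraicGeometry.Smooth (CategoryTheory.CategoryStruct.comp K.subschemeι r) → ∀ (τ : U' ⟶ U), Literature.AlgebraicGeometry.Resolution.IsBlowup τ K → AlgebraicGeometry.Smooth (CategoryTheory.CategoryStruct.comp τ r) := by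
  intro O _ _ _ _ _ U U' _ r _ K hK hKsm τ hτ
  haveI := hKsm
  set ικ := Spec.map (CommRingCat.ofHom (residue O)) with hικ
  -- (0) the centre is regular, `O`-flat, with regular special fibre
  haveI : IsRegularRing (CommRingCat.of O) := inferInstanceAs (IsRegularRing O)
  have hZreg : Scheme.IsRegular K.subscheme := Scheme.IsRegular.of_smooth (K.subschemeι ≫ r) (Scheme.isRegular_Spec (.of O))
  have hflat : Flat (K.subschemeι ≫ r) := inferInstance
  have hreg3 : Scheme.IsRegular ↑(pullback (K.subschemeι ≫ r) ικ) := fun z =>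
    isRegularLocalRing_stalk_of_smooth_of_field (pullback.snd (K.subschemeι ≫ r) ικ) z
  let e : ↑(K.comap (pullback.fst r ικ)).subscheme ⟶ ↑(pullback (K.subschemeι ≫ r) ικ) :=
    (K.comapIso (pullback.fst r ικ)).hom ≫ (pullbackSymmetry _ _).hom ≫ (pullbackRightPullbackFstIso r ικ K.subschemeι).hom
  have hZκ : Scheme.IsRegular (K.comap (pullback.fst r ικ)).subscheme := Scheme.IsRegular.of_isOpenImmersion e hreg3
  -- (1) good reduction everywhere on `U'`
  have hgood : ∀ w : U', GoodAt (τ ≫ r) w := goodAt_of_isBlowup_regularCentre O U U' r K hZreg hflat hZκ τ hτ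
  -- (2) `U' → Spec O` is locally of finite presentation and flat
  haveI : IsLocallyNoetherian U := LocallyOfFiniteType.isLocallyNoetherian r
  haveI : IsProper τ := stacks02NS_holds.of_isLocallyNoetherian τ K hτ
  haveI : LocallyOfFinitePresentation (τ ≫ r) := locallyOfFinitePresentation_of_isLocallyNoetherian' (τ ≫ r)
  haveI : IsIntegral U' := hτ.isIntegral hK
  haveI : Nonempty U := by
    obtain ⟨x, -⟩ := centreCompl_nonempty (X := U) hK
    exact ⟨x⟩
  haveI : IsDominant τ := isDominant_of_isBlowup hτ hK
  haveI : IsDominant r := isDominant_of_smooth_of_nonempty r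
  haveI : Flat (τ ≫ r) := flat_of_isIntegral_of_isDominant (τ ≫ r)
  -- (3) fibrewise criterion
  exact smooth_of_goodAt O U' (τ ≫ r) hgood

end Summit.ResolutionOfSingularities.ResolutionOfSingularities.Cruxes.EquisingularLift.StrataSplit

end
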